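import Summits.ABC.StewartYu.ArchG3Levels
import HarnessLib

/-!
# Cell abc-stewartyu, rung A1.L (crux r2 `ArchCoreRat`), WP-L.A parcel P-A5: the k-steps of the archimedean frame with STATE-INDEPENDENT
# record hypotheses (uniform over the unknown set `U ⊇ B` and the exponent box), and the chain of k-steps at one level

`Summits/ABC/StewartYu/ArchG3StepPacks.lean` — cell `abc-stewartyu` (HOME `run/shared/lean/pub/abc-stewartyu/`; TRANCHE PLAN v1.2 §4′ P-A5; seat lp-1
g8).  Definitions (`ArchKStepHypU`, `ArchKStepOddHypU` — `Prop`-valued packages of the record's data and inequalities for ONE k-step, quantified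
uniformly over `i ∈ U` and over all exponent vectors in the box `|wⱼ| ≤ Lⱼ`, hence independent of the evolving family `B ⊆ U`, `v`, `pv`)
and theorems on `ArchG3Setup.ArchLvInv` consuming them (`kstep_of_hypU`, `kstep_odd_of_hypU`, `kchain`, `levelRun`).  Archimedean twin of
`PadicG3StepPacks` (`G3Setup.KStepHypU`, `kstep_of_hypU`) and of `PadicG3Schedule.kchain` (seat p2-g4).  No named fact; no numerics.

The packages carry, besides the schedule data `t` (`T′ + t ≤ T`) and the node radii, exactly the currencies of `ArchLvInv.kstep`: `Aₖ ≥ |log αₖ|`,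
`Γₖ ≥ |𝔛ₖ(w)/b_{j₀}|` on the box, the Δ-weight size `DΔ ≥ |∏ₖ multichoose(yₖ(w), μₖ)|` on the box for `a + |μ| < T′` (so `PΔ = P·DΔ`), the
Hasse-weight sizes `Wd` (complex disc) and `Wn` (integer nodes), the radius ratio `E ≥ 1`, the jets scale `C ≥ 1`, the clearing denominators
`den₀`, the smallness `L_{j₀}·δ₀·(radius) ≤ 1` for the frame's majorant `δ₀ ≥ |Λ/b_{j₀}|` (the negated lower bound), and the numerical
inequality of the step with `#U` in place of `#B` and a majorant `γb ≥ |γ|` of the slab centre.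

* `ArchLvInv.kstep_of_hypU` / `kstep_odd_of_hypU` — one k-step from the package (`B ⊆ U`, `|Λ/b_{j₀}| ≤ δ₀`);
* `ArchLvInv.kchain` — `k` consecutive symmetric k-steps along schedules `N ν`, `T ν`;
* `ArchLvInv.levelRun` — the k-steps of one level: odd-node step `𝒳_{s,0} → 𝒳_{s,1}` then `k` symmetric steps (the half-step that
  produces the odd-node state of the next level is P-A6's).

WHAT THIS IS NOT: the half-step package and the schedule across levels (P-A6 / frame assembly), the START and the records; no crux moves.

## References
* Yu. V. Nesterenko, LNM 1819 (2003) — §4 Prop. 4.1, §4.2 (4.24)–(4.35), p. 80–90. [Nesterenko2003]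
* K. Yu, Acta Math. 211 (2013) — §5 (the `p`-adic model). [Yu2013]
-/

noncomputable section

open Finset Polynomial
open Literature.NumberTheory.Transcendental
open Literature.NumberTheory.Transcendental.CW77.Setup (Tau tauNorm)
open scoped Nat

namespace Summit.ABC.StewartYu

namespace ArchG3Setup

variable (S : ArchG3Setup) {ι : Type*}

/-! ### The packages -/

/-- **Record package of one archimedean k-step** (symmetric nodes `|x| ≤ N → |x| ≤ N′`, orders `T → T′`), uniform over `i ∈ U` and the
box `|wⱼ| ≤ Lⱼ`; `δ₀` is the frame's majorant of `|Λ/b_{j₀}|`, `γb` of the slab centre `|γ|`. [cite: Nesterenko2003, §4.2 (4.24)–(4.35), p. 87–90; shape only] -/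
def ArchKStepHypU (R : ι → ℚ[X]) (U : Finset ι) (L : Fin S.n → ℕ) (P : ℤ) (w γb : ℝ) (c : ℤ) (e : Fin S.n → ℤ) (δ₀ : ℝ)
    (N N' T T' : ℕ) : Prop :=
  ∃ (t : ℕ) (A Γ : Fin S.n → ℝ) (DΔ E Wd Wn C : ℝ) (den₀ : ℕ → ℤ → ℕ),
    1 ≤ t ∧ T' + t ≤ T ∧ N' ≤ 3 * N + 2 ∧
    (∀ k, |S.lg k| ≤ A k) ∧ (∀ k, 0 ≤ Γ k) ∧
    (∀ w' : Fin S.n → ℤ, (∀ j, |w' j| ≤ (L j : ℤ)) → ∀ k, |(S.zγ w' k : ℝ)| ≤ Γ k) ∧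
    0 ≤ DΔ ∧
    (∀ w' : Fin S.n → ℤ, (∀ j, |w' j| ≤ (L j : ℤ)) → ∀ (a : ℕ) (μ : Fin S.n → ℕ), a + ∑ k, μ k < T' →
      |((∏ k, Ring.multichoose (S.yΔ c e w' k) (μ k) : ℤ) : ℝ)| ≤ DΔ) ∧
    1 ≤ E ∧
    (∀ i ∈ U, ∀ a < T', ∀ z : ℂ, ‖z‖ ≤ (3 * E + 1) * (2 * N + 1) + N → ‖(hw R i a).eval z‖ ≤ Wd) ∧
    0 ≤ Wn ∧
    (∀ i ∈ U, ∀ t₀ < T, ∀ x : ℤ, |x| ≤ 3 * (N : ℤ) + 2 → |(((hasseDeriv t₀ (R i)).eval (x : ℚ) : ℚ) : ℝ)| ≤ Wn) ∧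
    0 ≤ w ∧ (L S.j₀ : ℝ) * δ₀ * (3 * N + 2) ≤ 1 ∧ 1 ≤ C ∧
    (∀ a x, 1 ≤ den₀ a x) ∧
    (∀ a < T', ∀ x : ℤ, |x| ≤ (N' : ℤ) → ∀ i ∈ U, ∃ z₀ : ℤ, (den₀ a x : ℚ) * (hasseDeriv a (R i)).eval (x : ℚ) = z₀) ∧
    (∀ x₁ : ℤ, |x₁| ≤ (N' : ℤ) → ∀ (a : ℕ) (μ : Fin S.n → ℕ), a + ∑ k, μ k < T' →
      Real.exp (γb * N') *
        (2 * ((2 * N + 1 : ℕ) : ℝ) ^ (t + 1) * t * (20 * Real.exp 1) ^ ((2 * N + 1) * t) *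
            ((2 * C) ^ t * Real.exp (γb * (N + 1)) *
              ((2 : ℝ) ^ a * Real.exp ((∑ k, A k * Γ k) / C) *
                (U.card * (P * DΔ) * Wn * Real.exp ((γb + w) * N) * (2 * ((L S.j₀ : ℝ) * δ₀ * N))))) +
          U.card * (P * DΔ) * Wd * Real.exp ((w + (L S.j₀ : ℝ) * δ₀) * ((3 * E + 1) * (2 * N + 1) + N)) *
            (1 / E) ^ ((2 * N + 1) * t)) +
        U.card * (P * DΔ) * Wn * Real.exp ((γb + w) * N') * (2 * ((L S.j₀ : ℝ) * δ₀ * N')) <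
      1 / ((den₀ a x₁ * MonomialDen.monDen S.α (fun j => L j * x₁.natAbs) : ℕ) : ℝ))

/-- **Record package of the first k-step of a level** (odd nodes `|x| ≤ 2m − 1 → |x| ≤ N′`, orders `T → T′`).
[cite: Nesterenko2003, §4.2 with the nodes 𝒳_{s,0}, p. 87–90; shape only] -/
def ArchKStepOddHypU (R : ι → ℚ[X]) (U : Finset ι) (L : Fin S.n → ℕ) (P : ℤ) (w γb : ℝ) (c : ℤ) (e : Fin S.n → ℤ) (δ₀ : ℝ)
    (m N' T T' : ℕ) : Prop :=
  ∃ (t : ℕ) (A Γ : Fin S.n → ℝ) (DΔ E Wd Wn C : ℝ) (den₀ : ℕ → ℤ → ℕ),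
    1 ≤ m ∧ 1 ≤ t ∧ T' + t ≤ T ∧ N' ≤ 6 * m ∧
    (∀ k, |S.lg k| ≤ A k) ∧ (∀ k, 0 ≤ Γ k) ∧
    (∀ w' : Fin S.n → ℤ, (∀ j, |w' j| ≤ (L j : ℤ)) → ∀ k, |(S.zγ w' k : ℝ)| ≤ Γ k) ∧
    0 ≤ DΔ ∧
    (∀ w' : Fin S.n → ℤ, (∀ j, |w' j| ≤ (L j : ℤ)) → ∀ (a : ℕ) (μ : Fin S.n → ℕ), a + ∑ k, μ k < T' →
      |((∏ k, Ring.multichoose (S.yΔ c e w' k) (μ k) : ℤ) : ℝ)| ≤ DΔ) ∧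
    1 ≤ E ∧
    (∀ i ∈ U, ∀ a < T', ∀ z : ℂ, ‖z‖ ≤ (12 * E + 6) * m → ‖(hw R i a).eval z‖ ≤ Wd) ∧
    0 ≤ Wn ∧
    (∀ i ∈ U, ∀ t₀ < T, ∀ x : ℤ, |x| ≤ 6 * (m : ℤ) → |(((hasseDeriv t₀ (R i)).eval (x : ℚ) : ℚ) : ℝ)| ≤ Wn) ∧
    0 ≤ w ∧ (L S.j₀ : ℝ) * δ₀ * (6 * m) ≤ 1 ∧ 1 ≤ C ∧
    (∀ a x, 1 ≤ den₀ a x) ∧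
    (∀ a < T', ∀ x : ℤ, |x| ≤ (N' : ℤ) → ∀ i ∈ U, ∃ z₀ : ℤ, (den₀ a x : ℚ) * (hasseDeriv a (R i)).eval (x : ℚ) = z₀) ∧
    (∀ x₁ : ℤ, |x₁| ≤ (N' : ℤ) → ∀ (a : ℕ) (μ : Fin S.n → ℕ), a + ∑ k, μ k < T' →
      Real.exp (γb * N') *
        (2 * ((2 * m : ℕ) : ℝ) ^ (t + 1) * t * (20 * Real.exp 1) ^ ((2 * m) * t) *
            (2 ^ t * ((2 * C) ^ t * Real.exp (γb * (2 * m)) *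
              ((2 : ℝ) ^ a * Real.exp ((∑ k, A k * Γ k) / C) *
                (U.card * (P * DΔ) * Wn * Real.exp ((γb + w) * ((2 * m - 1 : ℕ) : ℝ)) *
                  (2 * ((L S.j₀ : ℝ) * δ₀ * ((2 * m - 1 : ℕ) : ℝ))))))) +
          U.card * (P * DΔ) * Wd * Real.exp ((w + (L S.j₀ : ℝ) * δ₀) * ((12 * E + 6) * m)) * (1 / E) ^ ((2 * m) * t)) +
        U.card * (P * DΔ) * Wn * Real.exp ((γb + w) * N') * (2 * ((L S.j₀ : ℝ) * δ₀ * N')) <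
      1 / ((den₀ a x₁ * MonomialDen.monDen S.α (fun j => L j * x₁.natAbs) : ℕ) : ℝ))

/-! ### The k-steps from the packages -/

namespace ArchLvInv

variable {S} {R : ι → ℚ[X]} {U B : Finset ι} {v : ι → Fin S.n → ℤ} {pv : ι → ℤ} {lo : Fin S.n → ℤ} {L : Fin S.n → ℕ} {P : ℤ}
  {w γ γb : ℝ} {c : ℤ} {e : Fin S.n → ℤ} {δ₀ : ℝ} {T T' N N' m : ℕ}

/-- `0 ≤ P` (some coefficient is non-zero and bounded by `P`). [folklore] -/
theorem P_nonneg {Xs : Set ℤ} (h : S.ArchLvInv R B v pv lo L P w γ c e Xs T) : (0 : ℝ) ≤ P := by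
  obtain ⟨i₀, hi₀, _⟩ := h.nonzero
  exact_mod_cast (abs_nonneg _).trans (h.bound i₀ hi₀)

/-- `|pvΔ μ i| ≤ P · DΔ` on `B` when `DΔ` bounds the Δ-weights on the box. [cite: Nesterenko2003, §3.5 (3.37), p. 75; shape only] -/
theorem abs_pvΔ_le_of_box {Xs : Set ℤ} (h : S.ArchLvInv R B v pv lo L P w γ c e Xs T) {DΔ : ℝ}
    {μ : Fin S.n → ℕ}
    (hDΔ : ∀ w' : Fin S.n → ℤ, (∀ j, |w' j| ≤ (L j : ℤ)) → |((∏ k, Ring.multichoose (S.yΔ c e w' k) (μ k) : ℤ) : ℝ)| ≤ DΔ) :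
    ∀ i ∈ B, |(S.pvΔ v pv c e μ i : ℝ)| ≤ P * DΔ := by
  intro i hi
  have e1 : (S.pvΔ v pv c e μ i : ℝ) = (pv i : ℝ) * ((∏ k, Ring.multichoose (S.yΔ c e (v i) k) (μ k) : ℤ) : ℝ) := by
    simp only [ArchG3Setup.pvΔ]; push_cast; rfl
  rw [e1, abs_mul]
  have h1 : |(pv i : ℝ)| ≤ P := by exact_mod_cast h.bound i hi
  exact mul_le_mul h1 (hDΔ (v i) (h.abs_le i hi)) (abs_nonneg _) h.P_nonneg

/-- **One k-step from the uniform package** (`B ⊆ U`, `|Λ/b_{j₀}| ≤ δ₀`). [cite: Nesterenko2003, §4.2 (4.24)–(4.35), p. 87–90] -/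
theorem kstep_of_hypU (hBU : B ⊆ U) (h : S.ArchLvInv R B v pv lo L P w γ c e {x : ℤ | |x| ≤ (N : ℤ)} T)
    (hΛ : |S.Λ / (S.b S.j₀ : ℝ)| ≤ δ₀) (hγ : |γ| ≤ γb) (H : S.ArchKStepHypU R U L P w γb c e δ₀ N N' T T') :
    S.ArchLvInv R B v pv lo L P w γ c e {x : ℤ | |x| ≤ (N' : ℤ)} T' := by
  obtain ⟨t, A, Γ, DΔ, E, Wd, Wn, C, den₀, ht, hT, hN', hA, hΓ0, hΓ, hDΔ0, hDΔ, hE, hWd, hWn0, hWn, hw0, hsmall, hC, hden₀, hR,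
    hfinal⟩ := H
  obtain ⟨i₀, hi₀B, _⟩ := h.nonzero
  have hBc : (B.card : ℝ) ≤ U.card := by exact_mod_cast card_le_card hBU
  have hPD : 0 ≤ (P : ℝ) * DΔ := mul_nonneg h.P_nonneg hDΔ0
  refine h.kstep ht hT hN' hBc hA hΓ0 (fun i hi k => hΓ (v i) (h.abs_le i hi) k) hPD
    (fun a μ haμ => h.abs_pvΔ_le_of_box fun w' hw' => hDΔ w' hw' a μ haμ) hE (fun i hi => hWd i (hBU hi)) hWn0
    (fun i hi => hWn i (hBU hi)) hw0 hΛ hsmall hC den₀ hden₀ (fun a ha x hx i hi => hR a ha x hx i (hBU hi)) ?_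
  intro x₁ hx₁ a μ haμ
  refine lt_of_le_of_lt ?_ (hfinal x₁ hx₁ a μ haμ)
  have hγ0 : 0 ≤ |γ| := abs_nonneg _
  have hWd0 : 0 ≤ Wd := le_trans (norm_nonneg _) (hWd i₀ (hBU hi₀B) a (by omega) 0 (by simp; positivity))
  have hU0 : (0 : ℝ) ≤ U.card := Nat.cast_nonneg _
  have hδ₀ : 0 ≤ δ₀ := (abs_nonneg _).trans hΛ
  have hC0 : 0 < C := by linarith
  set PD : ℝ := (P : ℝ) * DΔ with hPDdef
  gcongr

/-- **The first k-step of a level from the uniform package.** [cite: Nesterenko2003, §4.2 with the nodes 𝒳_{s,0}, p. 87–90] -/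
theorem kstep_odd_of_hypU (hBU : B ⊆ U) (h : S.ArchLvInv R B v pv lo L P w γ c e {x : ℤ | Odd x ∧ |x| ≤ 2 * (m : ℤ) - 1} T)
    (hΛ : |S.Λ / (S.b S.j₀ : ℝ)| ≤ δ₀) (hγ : |γ| ≤ γb) (H : S.ArchKStepOddHypU R U L P w γb c e δ₀ m N' T T') :
    S.ArchLvInv R B v pv lo L P w γ c e {x : ℤ | |x| ≤ (N' : ℤ)} T' := by
  obtain ⟨t, A, Γ, DΔ, E, Wd, Wn, C, den₀, hm, ht, hT, hN', hA, hΓ0, hΓ, hDΔ0, hDΔ, hE, hWd, hWn0, hWn, hw0, hsmall, hC, hden₀,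
    hR, hfinal⟩ := H
  obtain ⟨i₀, hi₀B, _⟩ := h.nonzero
  have hBc : (B.card : ℝ) ≤ U.card := by exact_mod_cast card_le_card hBU
  have hPD : 0 ≤ (P : ℝ) * DΔ := mul_nonneg h.P_nonneg hDΔ0
  refine h.kstep_odd hm ht hT hN' hBc hA hΓ0 (fun i hi k => hΓ (v i) (h.abs_le i hi) k) hPD
    (fun a μ haμ => h.abs_pvΔ_le_of_box fun w' hw' => hDΔ w' hw' a μ haμ) hE (fun i hi => hWd i (hBU hi)) hWn0
    (fun i hi => hWn i (hBU hi)) hw0 hΛ hsmall hC den₀ hden₀ (fun a ha x hx i hi => hR a ha x hx i (hBU hi)) ?_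
  intro x₁ hx₁ a μ haμ
  refine lt_of_le_of_lt ?_ (hfinal x₁ hx₁ a μ haμ)
  have hγ0 : 0 ≤ |γ| := abs_nonneg _
  have hWd0 : 0 ≤ Wd := le_trans (norm_nonneg _) (hWd i₀ (hBU hi₀B) a (by omega) 0 (by simp; positivity))
  have hU0 : (0 : ℝ) ≤ U.card := Nat.cast_nonneg _
  have hδ₀ : 0 ≤ δ₀ := (abs_nonneg _).trans hΛ
  have hC0 : 0 < C := by linarith
  set PD : ℝ := (P : ℝ) * DΔ with hPDdef
  gcongr

/-! ### The chain of k-steps at one level -/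

/-- **`k` consecutive symmetric k-steps** along the schedules `N ν` (node radii) and `T ν` (orders), from `ν₀` to `ν₀ + k`.
[cite: Nesterenko2003, §4.2 (the induction on ν), p. 84–90] -/
theorem kchain (hBU : B ⊆ U) (hΛ : |S.Λ / (S.b S.j₀ : ℝ)| ≤ δ₀) (hγ : |γ| ≤ γb) (Nν Tν : ℕ → ℕ) (ν₀ : ℕ) :
    ∀ k : ℕ, (∀ ν, ν₀ ≤ ν → ν < ν₀ + k → S.ArchKStepHypU R U L P w γb c e δ₀ (Nν ν) (Nν (ν + 1)) (Tν ν) (Tν (ν + 1))) →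
      S.ArchLvInv R B v pv lo L P w γ c e {x : ℤ | |x| ≤ (Nν ν₀ : ℤ)} (Tν ν₀) →
      S.ArchLvInv R B v pv lo L P w γ c e {x : ℤ | |x| ≤ (Nν (ν₀ + k) : ℤ)} (Tν (ν₀ + k)) := by
  intro k
  induction k with
  | zero => intro _ h; simpa using h
  | succ k ih =>
    intro hyp h
    have h1 := ih (fun ν h0 h1 => hyp ν h0 (by omega)) h
    have h2 := kstep_of_hypU hBU h1 hΛ hγ (hyp (ν₀ + k) (by omega) (by omega))
    rwa [show ν₀ + (k + 1) = ν₀ + k + 1 by omega]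

/-- **The k-steps of one level**: from the odd-node state (`𝒳_{s,0}`: odd `|x| ≤ 2m − 1`, order `Tν 0`) through the odd-node step to
`(Nν 1, Tν 1)` and then `k` symmetric steps to `(Nν (1 + k), Tν (1 + k))`. [cite: Nesterenko2003, §4 Prop. 4.1, §4.2, p. 80–90] -/
theorem levelRun (hBU : B ⊆ U) (hΛ : |S.Λ / (S.b S.j₀ : ℝ)| ≤ δ₀) (hγ : |γ| ≤ γb) (Nν Tν : ℕ → ℕ) (k : ℕ)
    (hO : S.ArchKStepOddHypU R U L P w γb c e δ₀ m (Nν 1) (Tν 0) (Tν 1))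
    (hK : ∀ ν, 1 ≤ ν → ν < 1 + k → S.ArchKStepHypU R U L P w γb c e δ₀ (Nν ν) (Nν (ν + 1)) (Tν ν) (Tν (ν + 1)))
    (h : S.ArchLvInv R B v pv lo L P w γ c e {x : ℤ | Odd x ∧ |x| ≤ 2 * (m : ℤ) - 1} (Tν 0)) :
    S.ArchLvInv R B v pv lo L P w γ c e {x : ℤ | |x| ≤ (Nν (1 + k) : ℤ)} (Tν (1 + k)) :=
  kchain hBU hΛ hγ Nν Tν 1 k hK (kstep_odd_of_hypU hBU h hΛ hγ hO)

end ArchLvInv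

end ArchG3Setup

end Summit.ABC.StewartYu

end
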